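import Literature.MathematicalPhysics.QuantumFieldTheory.Balaban1983to89.B1Eq324BenfattoSect5PerBoxAtPavement
import HarnessLib

/-!
# `Balaban1983to89.B1Eq324BenfattoSect5CrossPalette` — [BenfattoEtAl1978] §5 p. 159: THE PALETTE OF THE FREE-SIDE TELESCOPE AS TUPLE CLASSES —
# `H_{Γ₁}`, `Ψ′₁(□)+Ψ₂(□)`, `Ψ″₁(□)` as disjoint tuple classes with print's four geometric properties (the inputs of the sibling seat's closed CROSS bound)

statement-level skeleton of published theorems with citation tags; proofs where landed; nothing here is a claim about the
Yang–Mills mass gap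

WHY THIS MODULE (cell `pub-ymgap`, seat `dag-n08-c` gen 19; node N08 [Balaban1985UV3]).  The CROSS term of `…Sect5Identification` (the colourings of
`…FreeStep.sum_truncatedExp_sub_eq_telescope` using a `Ψ″₁(□)` slot and a slot outside `□`'s two colours) is bounded by dag-n08-b's
`…FreeStepCrossBound.abs_cross_le_closed` for ANY palette of tuple classes `cls : Option (↥B × Bool) → (p : ℕ) → Finset (Fin p → J)` with: deep
`(m,true)`-tuples meet `shrink L m (2w+v)`; `none`-tuples inside `Γ₁`; `(m,·)`-tuples inside `□_m`; classes pairwise disjoint — «the assembler's set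
bookkeeping».  This file supplies print's palette — `none ↦ tuplesIn Γ₁`, `(m,false) ↦ T0(m) ∪ T2(m)` (`Ψ′₁+Ψ₂`), `(m,true) ↦ T1(m)` (`Ψ″₁`), EMPTIED IN
DEGREE `0` (every `tuplesIn`-class contains the empty tuple at `p = 0`, and the Hamiltonians never read `p = 0`) — proves the four properties, and shows
the palette SUMS are the palette FUNCTIONS of the telescope (so the CROSS term IS `abs_cross_le_closed`'s left side).

WHAT IS PROVED (theorems only; no definition, no named fact, no `sorry`; axioms standard).
* `disjoint_T0_T2`, `disjoint_T1_T2`, `disjoint_T1_T0`, `not_mem_tuplesIn_corridors_of_mem_box_class` (the in-box classes miss `tuplesIn Γ₁`),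
  ★ `palette_pairwiseDisjoint` (the `hdisj` of `abs_cross_le_closed`), `palette_deep`, `palette_none`, `palette_box`, ★ `palette_eq_tupleSum` (the palette
  functions of the telescope are the sums over the palette classes).

HONEST SCOPE / NOT HERE.  Finite-set bookkeeping; the CROSS bound itself is dag-n08-b's.  `BasicLemmaPrinted` stays OPEN; count-neutral for N08; nothing of
[Balaban1985UV3] (41)/(47)/(5) is asserted; nothing about d = 4, the continuum, OS axioms, a mass gap or the Clay problem.
-/

noncomputable section

open MeasureTheory ProbabilityTheory Finset
open scoped BigOperators Nat

namespace Literature.MathematicalPhysics.QuantumFieldTheory.Balaban1983to89.B1Eq324BenfattoSect5CrossPalette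

open _root_.MeasureTheory _root_.ProbabilityTheory
open Literature.MathematicalPhysics.QuantumFieldTheory
open Literature.MathematicalPhysics.QuantumFieldTheory.Balaban1983to89.B1Eq324BenfattoLemma
open Literature.MathematicalPhysics.QuantumFieldTheory.Balaban1983to89.B1Eq324BenfattoSect5Boxes
open Literature.MathematicalPhysics.QuantumFieldTheory.Balaban1983to89.B1Eq324BenfattoSect5Eq511
open Literature.MathematicalPhysics.QuantumFieldTheory.Balaban1983to89.B1Eq324BenfattoSect5Eq524
open Literature.MathematicalPhysics.QuantumFieldTheory.Balaban1983to89.B1Eq324BenfattoSect5Eq534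
open Literature.MathematicalPhysics.QuantumFieldTheory.Balaban1983to89.B1Eq324BenfattoSect5PerBoxOnData
  (psi1p_eq_tupleSum psi1pp_eq_tupleSum psi2_eq_tupleSum)
open Literature.MathematicalPhysics.QuantumFieldTheory.Balaban1983to89.B1Eq324BenfattoSect5PerBoxAtPavement (classes_subset_box)

variable {d : ℕ}

section Palette

variable {s D : ℕ} {κ : ℝ} {a : Coef d} {J : Finset (B1Eq324BenfattoLemma.Site d)} {L w v : ℕ} {B : Finset (B1Eq324BenfattoLemma.Site d)}
  {m : B1Eq324BenfattoLemma.Site d}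

/-- **`T0(□) ∩ T2(□) = ∅`** (degree `p ≥ 1`): `T0`-tuples lie inside `Γ₄ ∪ Γ₃ ⊆ shrink w`; a `T2`-tuple either meets `Γ₁` (disjoint from `shrink w`) or lies
inside `Γ₂` — then inside `Γ₃ = Γ₂ ∩ (Γ₄∪Γ₃)`, which neither a tuple inside `Γ₄` nor one crossing `Γ₄|Γ₃` can do (`Γ₄ ⊆ □′`, `□′ ∩ Γ₂ = ∅`).
[cite: BenfattoEtAl1978, (5.7) p.154, (5.23)–(5.27) p.157] -/
theorem disjoint_T0_T2 {p : ℕ} (hp : 0 < p) (hv : v ≤ w) :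
    Disjoint (tuplesIn J p (frame4 L w v m) ∪ crossT J p (frame4 L w v m) (frame3 L w v m))
      (crossT J p (frame1 L w m) (frame2 L w m) ∪ tuplesIn J p (frame2 L w m)) := by
  rw [Finset.disjoint_left]
  intro Δ h0 h2
  -- every tessera of a `T0`-tuple is in `Γ₄ ∪ Γ₃ ⊆ shrink w`
  have h43 : ∀ i, (Δ i : B1Eq324BenfattoLemma.Site d) ∈ frame4 L w v m ∪ frame3 L w v m := fun i => by
    rcases Finset.mem_union.1 h0 with h | h
    · exact Finset.mem_union_left _ ((mem_tuplesIn.1 h) i)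
    · exact (mem_crossT.1 h).1 i
  have hsw : ∀ i, (Δ i : B1Eq324BenfattoLemma.Site d) ∈ shrink L m w := fun i => by
    rw [← core_union_frame2]
    rcases Finset.mem_union.1 (h43 i) with h | h
    · exact Finset.mem_union_left _ (frame4_subset_core L w v m h)
    · exact Finset.mem_union_right _ (frame3_subset_frame2 L hv m h)
  rcases Finset.mem_union.1 h2 with h | h
  · -- crossing `Γ₁|Γ₂`: not inside `Γ₂`, inside `Γ₁ ∪ Γ₂` ⇒ some tessera in `Γ₁`, contradiction with `shrink w`
    obtain ⟨hin, -, hn2⟩ := mem_crossT.1 h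
    apply hn2
    intro i
    rcases Finset.mem_union.1 (hin i) with h1 | h2'
    · exact absurd (hsw i) (Finset.disjoint_left.1 (disjoint_frame1_shrink L w m) h1)
    · exact h2'
  · -- inside `Γ₂`: every tessera in `Γ₂ ∩ (Γ₄ ∪ Γ₃) ⊆ Γ₃`; then `Δ` is neither inside `Γ₄` nor crossing `Γ₄|Γ₃`
    have hf2 : ∀ i, (Δ i : B1Eq324BenfattoLemma.Site d) ∈ frame2 L w m := mem_tuplesIn.1 h
    have hnot4 : ∀ i, (Δ i : B1Eq324BenfattoLemma.Site d) ∉ frame4 L w v m := fun i h4 =>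
      Finset.disjoint_left.1 (disjoint_frame4_frame2 L w v m) h4 (hf2 i)
    rcases Finset.mem_union.1 h0 with h | h
    · exact hnot4 ⟨0, hp⟩ ((mem_tuplesIn.1 h) ⟨0, hp⟩)
    · obtain ⟨-, -, hn3⟩ := mem_crossT.1 h
      apply hn3
      intro i
      rcases Finset.mem_union.1 (h43 i) with h4 | h3
      · exact absurd h4 (hnot4 i)
      · exact h3

/-- **`T1(□) ∩ T2(□) = ∅`** (`p ≥ 1`): `T1`-tuples either lie inside `□′` or meet `□′` (crossing `□′|Γ₃`); `T2`-tuples lie inside `Γ₁ ∪ Γ₂`, which misses `□′`.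
[cite: BenfattoEtAl1978, (5.7) p.154, (5.23)–(5.27) p.157] -/
theorem disjoint_T1_T2 {p : ℕ} (hp : 0 < p) :
    Disjoint ((tuplesIn J p (core L w m) \ tuplesIn J p (frame4 L w v m)) ∪
        (crossT J p (core L w m) (frame3 L w v m) \ crossT J p (frame4 L w v m) (frame3 L w v m)))
      (crossT J p (frame1 L w m) (frame2 L w m) ∪ tuplesIn J p (frame2 L w m)) := by
  rw [Finset.disjoint_left]
  intro Δ h1 h2
  -- a `T2`-tuple has every tessera in `Γ₁ ∪ Γ₂`, hence none in `□′`
  have h12 : ∀ i, (Δ i : B1Eq324BenfattoLemma.Site d) ∈ frame1 L w m ∪ frame2 L w m := fun i => by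
    rcases Finset.mem_union.1 h2 with h | h
    · exact (mem_crossT.1 h).1 i
    · exact Finset.mem_union_right _ ((mem_tuplesIn.1 h) i)
  have hnotcore : ∀ i, (Δ i : B1Eq324BenfattoLemma.Site d) ∉ core L w m := fun i hc => by
    rcases Finset.mem_union.1 (h12 i) with h | h
    · have hsw : (Δ i : B1Eq324BenfattoLemma.Site d) ∈ shrink L m w := by
        rw [← core_union_frame2]; exact Finset.mem_union_left _ hc
      exact Finset.disjoint_left.1 (disjoint_frame1_shrink L w m) h hsw
    · exact Finset.disjoint_left.1 (disjoint_core_frame2 L w m) hc h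
  rcases Finset.mem_union.1 h1 with h | h
  · exact hnotcore ⟨0, hp⟩ ((mem_tuplesIn.1 (Finset.mem_sdiff.1 h).1) ⟨0, hp⟩)
  · -- crossing `□′|Γ₃`: not inside `Γ₃` ⇒ some tessera in `□′`
    obtain ⟨hin, -, hn3⟩ := mem_crossT.1 (Finset.mem_sdiff.1 h).1
    apply hn3
    intro i
    rcases Finset.mem_union.1 (hin i) with hc | h3
    · exact absurd hc (hnotcore i)
    · exact h3

/-- **`T1(□) ∩ T0(□) = ∅`**: by construction (`T1` removes `tuplesIn Γ₄` and the `Γ₄|Γ₃` crossings; a tuple inside `Γ₄ ⊆ □′` is not a crossing of `□′|Γ₃`,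
a crossing of `Γ₄|Γ₃` is removed). [cite: BenfattoEtAl1978, (5.27) p.157] -/
theorem disjoint_T1_T0 {p : ℕ} :
    Disjoint ((tuplesIn J p (core L w m) \ tuplesIn J p (frame4 L w v m)) ∪
        (crossT J p (core L w m) (frame3 L w v m) \ crossT J p (frame4 L w v m) (frame3 L w v m)))
      (tuplesIn J p (frame4 L w v m) ∪ crossT J p (frame4 L w v m) (frame3 L w v m)) := by
  rw [Finset.disjoint_left]
  intro Δ h1 h0
  rcases Finset.mem_union.1 h0 with h4 | hx
  · -- `Δ` inside `Γ₄`
    rcases Finset.mem_union.1 h1 with h | h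
    · exact (Finset.mem_sdiff.1 h).2 h4
    · -- a crossing of `□′|Γ₃` is not inside `□′ ⊇ Γ₄`
      obtain ⟨-, hnc, -⟩ := mem_crossT.1 (Finset.mem_sdiff.1 h).1
      exact hnc fun i => frame4_subset_core L w v m ((mem_tuplesIn.1 h4) i)
  · -- `Δ` crossing `Γ₄|Γ₃`
    rcases Finset.mem_union.1 h1 with h | h
    · -- inside `□′` but a `Γ₄|Γ₃` crossing meets `Γ₃`, disjoint from `□′`
      obtain ⟨hin, hn4, -⟩ := mem_crossT.1 hx
      have hc : ∀ i, (Δ i : B1Eq324BenfattoLemma.Site d) ∈ core L w m := mem_tuplesIn.1 (Finset.mem_sdiff.1 h).1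
      apply hn4
      intro i
      rcases Finset.mem_union.1 (hin i) with h4 | h3
      · exact h4
      · exact absurd h3 (Finset.disjoint_left.1 (disjoint_core_frame3 L w v m) (hc i))
    · exact (Finset.mem_sdiff.1 h).2 hx

/-- **The in-box classes miss `tuplesIn Γ₁`** (`p ≥ 1`, `m ∈ B`): a tuple of the three classes of `□_m` has a tessera in `shrink L m w` — for `T0`, `T1`
all of them; for `T2` either all (inside `Γ₂`) or it crosses `Γ₁|Γ₂` and is not inside `Γ₁(□) = □ ∩ Γ₁` — and `Γ₁ ∩ shrink w = ∅`.
[cite: BenfattoEtAl1978, (5.8) p.155] -/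
theorem not_mem_tuplesIn_corridors_of_mem_box_class (hL : 0 < L) (hv : v ≤ w) {p : ℕ} (hp : 0 < p) (c : Fin 3) {Δ : Fin p → J}
    (hΔ : Δ ∈ (![fun p => tuplesIn J p (frame4 L w v m) ∪ crossT J p (frame4 L w v m) (frame3 L w v m),
        fun p => (tuplesIn J p (core L w m) \ tuplesIn J p (frame4 L w v m)) ∪
          (crossT J p (core L w m) (frame3 L w v m) \ crossT J p (frame4 L w v m) (frame3 L w v m)),
        fun p => crossT J p (frame1 L w m) (frame2 L w m) ∪ tuplesIn J p (frame2 L w m)] :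
          Fin 3 → (p : ℕ) → Finset (Fin p → J)) c p) :
    Δ ∉ tuplesIn J p (corridors L w B) := by
  intro hΓ
  have hΓ' : ∀ i, (Δ i : B1Eq324BenfattoLemma.Site d) ∈ corridors L w B := mem_tuplesIn.1 hΓ
  have hdis : ∀ i, (Δ i : B1Eq324BenfattoLemma.Site d) ∉ shrink L m w := fun i h =>
    Finset.disjoint_left.1 (disjoint_corridors_shrink hL w B m) (hΓ' i) h
  have hbox : ∀ i, (Δ i : B1Eq324BenfattoLemma.Site d) ∈ box L m := fun i => classes_subset_box hv c p Δ hΔ i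
  fin_cases c
  · simp only at hΔ
    have h43 : (Δ ⟨0, hp⟩ : B1Eq324BenfattoLemma.Site d) ∈ frame4 L w v m ∪ frame3 L w v m := by
      rcases Finset.mem_union.1 hΔ with h | h
      · exact Finset.mem_union_left _ ((mem_tuplesIn.1 h) _)
      · exact (mem_crossT.1 h).1 _
    apply hdis ⟨0, hp⟩
    rw [← core_union_frame2]
    rcases Finset.mem_union.1 h43 with h | h
    · exact Finset.mem_union_left _ (frame4_subset_core L w v m h)
    · exact Finset.mem_union_right _ (frame3_subset_frame2 L hv m h)
  · simp only at hΔ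
    have hc3 : (Δ ⟨0, hp⟩ : B1Eq324BenfattoLemma.Site d) ∈ core L w m ∪ frame3 L w v m := by
      rcases Finset.mem_union.1 hΔ with h | h
      · exact Finset.mem_union_left _ ((mem_tuplesIn.1 (Finset.mem_sdiff.1 h).1) _)
      · exact (mem_crossT.1 (Finset.mem_sdiff.1 h).1).1 _
    apply hdis ⟨0, hp⟩
    rw [← core_union_frame2]
    rcases Finset.mem_union.1 hc3 with h | h
    · exact Finset.mem_union_left _ h
    · exact Finset.mem_union_right _ (frame3_subset_frame2 L hv m h)
  · simp only at hΔ
    rcases Finset.mem_union.1 hΔ with h | h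
    · -- crossing `Γ₁|Γ₂`: has a tessera in `Γ₂ ⊆ shrink w`
      obtain ⟨hin, hn1, -⟩ := mem_crossT.1 h
      apply hn1
      intro i
      rcases Finset.mem_union.1 (hin i) with h1 | h2
      · exact h1
      · exfalso
        apply hdis i
        rw [← core_union_frame2]
        exact Finset.mem_union_right _ h2
    · apply hdis ⟨0, hp⟩
      rw [← core_union_frame2]
      exact Finset.mem_union_right _ ((mem_tuplesIn.1 h) _)

/-- **THE PALETTE IS PAIRWISE DISJOINT** (the `hdisj` of the sibling seat's `abs_cross_le_closed`), for the palette `none ↦ tuplesIn Γ₁`,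
`(m,false) ↦ T0(m)∪T2(m)`, `(m,true) ↦ T1(m)`, emptied in degree `0`: different boxes have disjoint tuples (`disjoint_box`), within a box the three classes are
disjoint (`disjoint_T0_T2`, `disjoint_T1_T2`, `disjoint_T1_T0`), and the in-box classes miss `tuplesIn Γ₁`. [cite: BenfattoEtAl1978, (5.7)–(5.9) pp.154–155, (5.27) p.157] -/
theorem palette_pairwiseDisjoint (hL : 0 < L) (hv : v ≤ w) :
    ∀ (p : ℕ) (c₁ c₂ : Option (↥B × Bool)), c₁ ≠ c₂ →
      Disjoint ((fun (c : Option (↥B × Bool)) (p : ℕ) =>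
        if p = 0 then (∅ : Finset (Fin p → J)) else
          Option.elim c (tuplesIn J p (corridors L w B))
            (fun mb => bif mb.2 then ((tuplesIn J p (core L w (mb.1 : B1Eq324BenfattoLemma.Site d)) \ tuplesIn J p (frame4 L w v (mb.1 : B1Eq324BenfattoLemma.Site d))) ∪ (crossT J p (core L w (mb.1 : B1Eq324BenfattoLemma.Site d)) (frame3 L w v (mb.1 : B1Eq324BenfattoLemma.Site d)) \ crossT J p (frame4 L w v (mb.1 : B1Eq324BenfattoLemma.Site d)) (frame3 L w v (mb.1 : B1Eq324BenfattoLemma.Site d))))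
              else (tuplesIn J p (frame4 L w v (mb.1 : B1Eq324BenfattoLemma.Site d)) ∪ crossT J p (frame4 L w v (mb.1 : B1Eq324BenfattoLemma.Site d)) (frame3 L w v (mb.1 : B1Eq324BenfattoLemma.Site d))) ∪ (crossT J p (frame1 L w (mb.1 : B1Eq324BenfattoLemma.Site d)) (frame2 L w (mb.1 : B1Eq324BenfattoLemma.Site d)) ∪ tuplesIn J p (frame2 L w (mb.1 : B1Eq324BenfattoLemma.Site d))))) c₁ p) ((fun (c : Option (↥B × Bool)) (p : ℕ) =>
        if p = 0 then (∅ : Finset (Fin p → J)) else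
          Option.elim c (tuplesIn J p (corridors L w B))
            (fun mb => bif mb.2 then ((tuplesIn J p (core L w (mb.1 : B1Eq324BenfattoLemma.Site d)) \ tuplesIn J p (frame4 L w v (mb.1 : B1Eq324BenfattoLemma.Site d))) ∪ (crossT J p (core L w (mb.1 : B1Eq324BenfattoLemma.Site d)) (frame3 L w v (mb.1 : B1Eq324BenfattoLemma.Site d)) \ crossT J p (frame4 L w v (mb.1 : B1Eq324BenfattoLemma.Site d)) (frame3 L w v (mb.1 : B1Eq324BenfattoLemma.Site d))))
              else (tuplesIn J p (frame4 L w v (mb.1 : B1Eq324BenfattoLemma.Site d)) ∪ crossT J p (frame4 L w v (mb.1 : B1Eq324BenfattoLemma.Site d)) (frame3 L w v (mb.1 : B1Eq324BenfattoLemma.Site d))) ∪ (crossT J p (frame1 L w (mb.1 : B1Eq324BenfattoLemma.Site d)) (frame2 L w (mb.1 : B1Eq324BenfattoLemma.Site d)) ∪ tuplesIn J p (frame2 L w (mb.1 : B1Eq324BenfattoLemma.Site d))))) c₂ p) := by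
  intro p c₁ c₂ hne
  by_cases hp0 : p = 0
  · simp only [hp0, if_true]
    exact Finset.disjoint_empty_left _
  have hp : 0 < p := Nat.pos_of_ne_zero hp0
  simp only [hp0, if_false]
  -- the in-box class of `(m, bb)` lies in the union of the three classes of `□_m`
  have hclass : ∀ (mb : ↥B × Bool) (Δ : Fin p → J),
      Δ ∈ Option.elim (some mb) (tuplesIn J p (corridors L w B))
        (fun mb => bif mb.2 then ((tuplesIn J p (core L w (mb.1 : B1Eq324BenfattoLemma.Site d)) \ tuplesIn J p (frame4 L w v (mb.1 : B1Eq324BenfattoLemma.Site d))) ∪ (crossT J p (core L w (mb.1 : B1Eq324BenfattoLemma.Site d)) (frame3 L w v (mb.1 : B1Eq324BenfattoLemma.Site d)) \ crossT J p (frame4 L w v (mb.1 : B1Eq324BenfattoLemma.Site d)) (frame3 L w v (mb.1 : B1Eq324BenfattoLemma.Site d))))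
          else (tuplesIn J p (frame4 L w v (mb.1 : B1Eq324BenfattoLemma.Site d)) ∪ crossT J p (frame4 L w v (mb.1 : B1Eq324BenfattoLemma.Site d)) (frame3 L w v (mb.1 : B1Eq324BenfattoLemma.Site d))) ∪ (crossT J p (frame1 L w (mb.1 : B1Eq324BenfattoLemma.Site d)) (frame2 L w (mb.1 : B1Eq324BenfattoLemma.Site d)) ∪ tuplesIn J p (frame2 L w (mb.1 : B1Eq324BenfattoLemma.Site d)))) →
      ∃ c : Fin 3, Δ ∈ (![fun p => tuplesIn J p (frame4 L w v (mb.1 : B1Eq324BenfattoLemma.Site d)) ∪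
            crossT J p (frame4 L w v (mb.1 : B1Eq324BenfattoLemma.Site d)) (frame3 L w v (mb.1 : B1Eq324BenfattoLemma.Site d)),
          fun p => (tuplesIn J p (core L w (mb.1 : B1Eq324BenfattoLemma.Site d)) \ tuplesIn J p (frame4 L w v (mb.1 : B1Eq324BenfattoLemma.Site d))) ∪
            (crossT J p (core L w (mb.1 : B1Eq324BenfattoLemma.Site d)) (frame3 L w v (mb.1 : B1Eq324BenfattoLemma.Site d)) \
              crossT J p (frame4 L w v (mb.1 : B1Eq324BenfattoLemma.Site d)) (frame3 L w v (mb.1 : B1Eq324BenfattoLemma.Site d))),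
          fun p => crossT J p (frame1 L w (mb.1 : B1Eq324BenfattoLemma.Site d)) (frame2 L w (mb.1 : B1Eq324BenfattoLemma.Site d)) ∪
            tuplesIn J p (frame2 L w (mb.1 : B1Eq324BenfattoLemma.Site d))] : Fin 3 → (p : ℕ) → Finset (Fin p → J)) c p := by
    rintro ⟨m, bb⟩ Δ hΔ
    cases bb
    · simp only [Option.elim, cond_false] at hΔ
      rcases Finset.mem_union.1 hΔ with h | h
      · exact ⟨0, h⟩
      · exact ⟨2, h⟩
    · simp only [Option.elim, cond_true] at hΔ
      exact ⟨1, hΔ⟩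
  rw [Finset.disjoint_left]
  intro Δ h1 h2
  rcases c₁ with _ | ⟨m₁, b₁⟩ <;> rcases c₂ with _ | ⟨m₂, b₂⟩
  · exact hne rfl
  · obtain ⟨c, hc⟩ := hclass _ Δ h2
    exact not_mem_tuplesIn_corridors_of_mem_box_class hL hv hp c hc h1
  · obtain ⟨c, hc⟩ := hclass _ Δ h1
    exact not_mem_tuplesIn_corridors_of_mem_box_class hL hv hp c hc h2
  · by_cases hm : (m₁ : B1Eq324BenfattoLemma.Site d) = (m₂ : B1Eq324BenfattoLemma.Site d)
    · -- same box: the Booleans differ; `T1` vs `T0 ∪ T2`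
      have hm' : m₁ = m₂ := Subtype.ext hm
      subst hm'
      have hb : b₁ ≠ b₂ := fun hb => hne (by rw [hb])
      have key : ∀ Δ' : Fin p → J, Δ' ∈ ((tuplesIn J p (core L w (m₁ : B1Eq324BenfattoLemma.Site d)) \ tuplesIn J p (frame4 L w v (m₁ : B1Eq324BenfattoLemma.Site d))) ∪ (crossT J p (core L w (m₁ : B1Eq324BenfattoLemma.Site d)) (frame3 L w v (m₁ : B1Eq324BenfattoLemma.Site d)) \ crossT J p (frame4 L w v (m₁ : B1Eq324BenfattoLemma.Site d)) (frame3 L w v (m₁ : B1Eq324BenfattoLemma.Site d)))) → Δ' ∈ (tuplesIn J p (frame4 L w v (m₁ : B1Eq324BenfattoLemma.Site d)) ∪ crossT J p (frame4 L w v (m₁ : B1Eq324BenfattoLemma.Site d)) (frame3 L w v (m₁ : B1Eq324BenfattoLemma.Site d))) ∪ (crossT J p (frame1 L w (m₁ : B1Eq324BenfattoLemma.Site d)) (frame2 L w (m₁ : B1Eq324BenfattoLemma.Site d)) ∪ tuplesIn J p (frame2 L w (m₁ : B1Eq324BenfattoLemma.Site d))) → False := fun Δ' hT1 hT02 => by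
        rcases Finset.mem_union.1 hT02 with h | h
        · exact Finset.disjoint_left.1 disjoint_T1_T0 hT1 h
        · exact Finset.disjoint_left.1 (disjoint_T1_T2 hp) hT1 h
      cases b₁ <;> cases b₂
      · exact hb rfl
      · simp only [Option.elim, cond_false, cond_true] at h1 h2
        exact key Δ h2 h1
      · simp only [Option.elim, cond_false, cond_true] at h1 h2
        exact key Δ h1 h2
      · exact hb rfl
    · -- different boxes
      obtain ⟨c₁', hc₁⟩ := hclass _ Δ h1
      obtain ⟨c₂', hc₂⟩ := hclass _ Δ h2
      have hx₁ := classes_subset_box hv c₁' p Δ hc₁ ⟨0, hp⟩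
      have hx₂ := classes_subset_box hv c₂' p Δ hc₂ ⟨0, hp⟩
      exact Finset.disjoint_left.1 (disjoint_box hL hm) hx₁ hx₂

/-- **The deep class meets `□′∖Γ₄ = shrink(2w+v)`** (the `hdeep` of `abs_cross_le_closed`): every `Ψ″₁(□)`-tuple has a tessera in `□′∖Γ₄(□)`
(`…Eq524.exists_mem_core_sdiff_frame4`). [cite: BenfattoEtAl1978, (5.27)–(5.29) p.157] -/
theorem palette_deep :
    ∀ (m : ↥B), ∀ p ∈ Finset.Icc 1 s, ∀ Δ ∈ (fun (c : Option (↥B × Bool)) (p : ℕ) =>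
        if p = 0 then (∅ : Finset (Fin p → J)) else
          Option.elim c (tuplesIn J p (corridors L w B))
            (fun mb => bif mb.2 then ((tuplesIn J p (core L w (mb.1 : B1Eq324BenfattoLemma.Site d)) \ tuplesIn J p (frame4 L w v (mb.1 : B1Eq324BenfattoLemma.Site d))) ∪ (crossT J p (core L w (mb.1 : B1Eq324BenfattoLemma.Site d)) (frame3 L w v (mb.1 : B1Eq324BenfattoLemma.Site d)) \ crossT J p (frame4 L w v (mb.1 : B1Eq324BenfattoLemma.Site d)) (frame3 L w v (mb.1 : B1Eq324BenfattoLemma.Site d))))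
              else (tuplesIn J p (frame4 L w v (mb.1 : B1Eq324BenfattoLemma.Site d)) ∪ crossT J p (frame4 L w v (mb.1 : B1Eq324BenfattoLemma.Site d)) (frame3 L w v (mb.1 : B1Eq324BenfattoLemma.Site d))) ∪ (crossT J p (frame1 L w (mb.1 : B1Eq324BenfattoLemma.Site d)) (frame2 L w (mb.1 : B1Eq324BenfattoLemma.Site d)) ∪ tuplesIn J p (frame2 L w (mb.1 : B1Eq324BenfattoLemma.Site d))))) (some (m, true)) p,
      ∃ i, (Δ i : B1Eq324BenfattoLemma.Site d) ∈ shrink L (m : B1Eq324BenfattoLemma.Site d) (2 * w + v) := by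
  intro m p hp Δ hΔ
  have hp0 : p ≠ 0 := by have := (Finset.mem_Icc.1 hp).1; omega
  simp only [hp0, if_false, Option.elim, cond_true] at hΔ
  exact exists_mem_core_sdiff_frame4 hΔ

/-- **The rest class lies inside `Γ₁`** (the `hnone` of `abs_cross_le_closed`). [cite: BenfattoEtAl1978, (5.8)–(5.9) p.155] -/
theorem palette_none :
    ∀ (p : ℕ), ∀ Δ ∈ (fun (c : Option (↥B × Bool)) (p : ℕ) =>
        if p = 0 then (∅ : Finset (Fin p → J)) else
          Option.elim c (tuplesIn J p (corridors L w B))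
            (fun mb => bif mb.2 then ((tuplesIn J p (core L w (mb.1 : B1Eq324BenfattoLemma.Site d)) \ tuplesIn J p (frame4 L w v (mb.1 : B1Eq324BenfattoLemma.Site d))) ∪ (crossT J p (core L w (mb.1 : B1Eq324BenfattoLemma.Site d)) (frame3 L w v (mb.1 : B1Eq324BenfattoLemma.Site d)) \ crossT J p (frame4 L w v (mb.1 : B1Eq324BenfattoLemma.Site d)) (frame3 L w v (mb.1 : B1Eq324BenfattoLemma.Site d))))
              else (tuplesIn J p (frame4 L w v (mb.1 : B1Eq324BenfattoLemma.Site d)) ∪ crossT J p (frame4 L w v (mb.1 : B1Eq324BenfattoLemma.Site d)) (frame3 L w v (mb.1 : B1Eq324BenfattoLemma.Site d))) ∪ (crossT J p (frame1 L w (mb.1 : B1Eq324BenfattoLemma.Site d)) (frame2 L w (mb.1 : B1Eq324BenfattoLemma.Site d)) ∪ tuplesIn J p (frame2 L w (mb.1 : B1Eq324BenfattoLemma.Site d))))) none p, ∀ i, (Δ i : B1Eq324BenfattoLemma.Site d) ∈ corridors L w B := by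
  intro p Δ hΔ i
  by_cases hp0 : p = 0
  · simp only [hp0, if_true] at hΔ
    exact absurd hΔ (Finset.notMem_empty _)
  · simp only [hp0, if_false, Option.elim] at hΔ
    exact (mem_tuplesIn.1 hΔ) i

/-- **The in-box classes lie inside their box** (the `hbox` of `abs_cross_le_closed`; `…PerBoxAtPavement.classes_subset_box`).
[cite: BenfattoEtAl1978, (5.7) p.154, (5.23)–(5.27) p.157] -/
theorem palette_box (hv : v ≤ w) :
    ∀ (m : ↥B) (bb : Bool) (p : ℕ), ∀ Δ ∈ (fun (c : Option (↥B × Bool)) (p : ℕ) =>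
        if p = 0 then (∅ : Finset (Fin p → J)) else
          Option.elim c (tuplesIn J p (corridors L w B))
            (fun mb => bif mb.2 then ((tuplesIn J p (core L w (mb.1 : B1Eq324BenfattoLemma.Site d)) \ tuplesIn J p (frame4 L w v (mb.1 : B1Eq324BenfattoLemma.Site d))) ∪ (crossT J p (core L w (mb.1 : B1Eq324BenfattoLemma.Site d)) (frame3 L w v (mb.1 : B1Eq324BenfattoLemma.Site d)) \ crossT J p (frame4 L w v (mb.1 : B1Eq324BenfattoLemma.Site d)) (frame3 L w v (mb.1 : B1Eq324BenfattoLemma.Site d))))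
              else (tuplesIn J p (frame4 L w v (mb.1 : B1Eq324BenfattoLemma.Site d)) ∪ crossT J p (frame4 L w v (mb.1 : B1Eq324BenfattoLemma.Site d)) (frame3 L w v (mb.1 : B1Eq324BenfattoLemma.Site d))) ∪ (crossT J p (frame1 L w (mb.1 : B1Eq324BenfattoLemma.Site d)) (frame2 L w (mb.1 : B1Eq324BenfattoLemma.Site d)) ∪ tuplesIn J p (frame2 L w (mb.1 : B1Eq324BenfattoLemma.Site d))))) (some (m, bb)) p, ∀ i,
      (Δ i : B1Eq324BenfattoLemma.Site d) ∈ box L (m : B1Eq324BenfattoLemma.Site d) := by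
  intro m bb p Δ hΔ i
  by_cases hp0 : p = 0
  · simp only [hp0, if_true] at hΔ
    exact absurd hΔ (Finset.notMem_empty _)
  simp only [hp0, if_false] at hΔ
  cases bb
  · simp only [Option.elim, cond_false] at hΔ
    rcases Finset.mem_union.1 hΔ with h | h
    · exact classes_subset_box (m := (m : B1Eq324BenfattoLemma.Site d)) hv 0 p Δ h i
    · exact classes_subset_box (m := (m : B1Eq324BenfattoLemma.Site d)) hv 2 p Δ h i
  · simp only [Option.elim, cond_true] at hΔ
    exact classes_subset_box (m := (m : B1Eq324BenfattoLemma.Site d)) hv 1 p Δ hΔ i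

/-- **THE PALETTE SUMS ARE THE PALETTE FUNCTIONS OF THE TELESCOPE**: for `A` supported in `J` and every colour `c`,
`Y(c)(z) = Σ_p Σ_{Δ ∈ cls c p} Σ_n term`, where `Y none = H_{Γ₁}`, `Y(m,false) = Ψ′₁(m)+Ψ₂(m)`, `Y(m,true) = Ψ″₁(m)` — so the CROSS sum of
`…Sect5Identification` (palette functions) IS the left side of `abs_cross_le_closed` (palette classes). [cite: BenfattoEtAl1978, (5.9) p.155, (5.23)–(5.27) p.157, (5.35) p.159] -/
theorem palette_eq_tupleSum (hJ : CoefSupportedIn a J) (hv : v ≤ w) (c : Option (↥B × Bool)) (z : B1Eq324BenfattoLemma.Site d → ℝ) :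
    (fun (c : Option (↥B × Bool)) (z : B1Eq324BenfattoLemma.Site d → ℝ) =>
        Option.elim c (hamiltonian s D κ a (corridors L w B) z)
          (fun mb => bif mb.2 then psi1pp s D κ a L w v (mb.1 : B1Eq324BenfattoLemma.Site d) z
            else psi1p s D κ a L w v (mb.1 : B1Eq324BenfattoLemma.Site d) z + psi2 s D κ a L w (mb.1 : B1Eq324BenfattoLemma.Site d) z)) c z =
      ∑ p ∈ Finset.Icc 1 s, ∑ Δ ∈ (fun (c : Option (↥B × Bool)) (p : ℕ) =>
        if p = 0 then (∅ : Finset (Fin p → J)) else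
          Option.elim c (tuplesIn J p (corridors L w B))
            (fun mb => bif mb.2 then ((tuplesIn J p (core L w (mb.1 : B1Eq324BenfattoLemma.Site d)) \ tuplesIn J p (frame4 L w v (mb.1 : B1Eq324BenfattoLemma.Site d))) ∪ (crossT J p (core L w (mb.1 : B1Eq324BenfattoLemma.Site d)) (frame3 L w v (mb.1 : B1Eq324BenfattoLemma.Site d)) \ crossT J p (frame4 L w v (mb.1 : B1Eq324BenfattoLemma.Site d)) (frame3 L w v (mb.1 : B1Eq324BenfattoLemma.Site d))))
              else (tuplesIn J p (frame4 L w v (mb.1 : B1Eq324BenfattoLemma.Site d)) ∪ crossT J p (frame4 L w v (mb.1 : B1Eq324BenfattoLemma.Site d)) (frame3 L w v (mb.1 : B1Eq324BenfattoLemma.Site d))) ∪ (crossT J p (frame1 L w (mb.1 : B1Eq324BenfattoLemma.Site d)) (frame2 L w (mb.1 : B1Eq324BenfattoLemma.Site d)) ∪ tuplesIn J p (frame2 L w (mb.1 : B1Eq324BenfattoLemma.Site d))))) c p, ∑ n ∈ admissible p D, term κ a z p Δ n := by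
  rcases c with _ | ⟨m, bb⟩
  · simp only [Option.elim]
    rw [hamiltonian_eq_sum_tuplesIn hJ]
    refine Finset.sum_congr rfl fun p hp => ?_
    have hp0 : p ≠ 0 := by have := (Finset.mem_Icc.1 hp).1; omega
    simp only [hp0, if_false]
  · cases bb
    · simp only [Option.elim, cond_false]
      rw [psi1p_eq_tupleSum hJ z, psi2_eq_tupleSum hJ z, ← Finset.sum_add_distrib]
      refine Finset.sum_congr rfl fun p hp => ?_
      have hp0 : p ≠ 0 := by have := (Finset.mem_Icc.1 hp).1; omega
      simp only [hp0, if_false]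
      rw [Finset.sum_union (disjoint_T0_T2 (Nat.pos_of_ne_zero hp0) hv)]
    · simp only [Option.elim, cond_true]
      rw [psi1pp_eq_tupleSum hJ z]
      refine Finset.sum_congr rfl fun p hp => ?_
      have hp0 : p ≠ 0 := by have := (Finset.mem_Icc.1 hp).1; omega
      simp only [hp0, if_false]

end Palette

end Literature.MathematicalPhysics.QuantumFieldTheory.Balaban1983to89.B1Eq324BenfattoSect5CrossPalette

end
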